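import Summits.QuantumFields.YangMills.Theorems.TwistedTraceScaling.Negative.ValleyConstProximityKit
import HarnessLib

/-!
# Negative lemma R10 for crux `TwistedTraceScaling` (stmt-QuantumFields-20203): on lane A's VALLEY SET `valleySet L δ η` no uniform
# `√η`-proximity to the CONSTANTS (even `L`) or to the FLAT configurations (every `L`) — for ANY scales `δ, η → 0`, in particular
# `(δ, η) = (β^{−p}, β^{−q})`, all `p, q > 0`

Standing disprover `ym-cdisprove-20203-1` (gen 10), skeleton of record «twolattice» rev 3 (stubs `stub_fixedLatticeTraceLaw` = S-BASE, worked by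
lanes A/B through the covariant valley door `…TwistedTraceScalingValleySchurDoor` (`valleySet`, `ValleyKernelRowBoundAt`); `stub_cmpTwoLoop`).
Lane A's design text of record for its brick C3c (COARSE-DESIGN §13–§14, adopted after R8/R9) reads: «a point of the valley region
`{S < 2η} ∖ ⋃_z τ_z(B_{δ/2}(pure gauge))` is, up to gauge, `√η`-close (per link) to a CONSTANT configuration», at the polynomial scales
`(δ, η) = (β^{−p}, β^{−q})` (`(p, q) = (1/8, 3/10)` proposed).  R9 (`…Negative.ConstProximityCentreTwist`) refuted the REGION-FREE form of this
(`S ≤ σ₀ ⇒ C·S^α`-close to constants, `α > 1/4`, even `L`), but its witness family runs INTO the excluded toron balls as `φ → 0`, so it does not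
formally meet the valley-restricted text.  This file does, for every pair of scale functions `δ, η : ℝ → ℝ` with `δ β → 0`, `η β → 0`, `η β > 0`
eventually (`valleyConstProximity_sqrt_false`, even `L`; corollary `valleyConstProximity_pow_false` at `powScale p, powScale q`, ALL `p, q > 0`):

  `¬ ∃ C β₀, ∀ β ≥ β₀, ∀ U ∈ valleySet L (δ β) (η β), ∃ g c, ∀ e, ‖(g·U)_e − c_{e.2}‖_F ≤ C·√(η β)`,

and the same with «constant `c`» replaced by «FLAT `V`» at EVERY `L ≥ 1` (`valleyFlatProximity_sqrt_false`, `valleyFlatProximity_pow_false`).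
Per-link (`ℓ^∞`) closeness is the weakest form, so every `ℓ²`/«stiff-norm» version with the same rate is refuted a fortiori.

## Witness and mechanism (kit: `…Negative.ValleyConstProximityKit`)
Two rotations about ORTHOGONAL axes with UNEQUAL angles: `a = (cos α, sin α, 0, 0)`, `b = (cos τ, 0, sin τ, 0)`, `α = θ/L`, `τ = L s/θ`, where
`s = √(η/(4·#Plaquette + 1))` and `θ = max(2Lδ, L√s) → 0`.  The configuration `twoLinkCfg a b` (and its centre twist `twist 2 (−1) ·`, same
plaquettes) has action `≤ 4·#Plaquette·sin²α·sin²τ ≤ (4·#P) (ατ)² = (4·#P) s² ≤ η < 2η`, and ALL EIGHT twisted copies stay at orbit distance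
`≥ α/2 ≥ δ` from the pure gauges: the direction-0 Polyakov loop is `±a^L`, `Re tr = ±2cos θ`, while `orbitDist < r` forces `Re tr P₀ ≥ 2 − (Lr)²/2`
(lane A's `re_trace_lineProd_ge_of_orbitDist_lt`, `lineProd_twist3_closed`).  So the witness lies in `valleySet L δ η` in every regime of `(δ, η)`.
Obstruction: R9's chain (even-power rigidity of `c₂`, almost-commutation, commuting shadows; resp. R8's commuting line holonomies of a flat field)
produces a COMMUTING pair within `Δ = L(1+2L)·C√η` (resp. `L·C√η`) of `(a^L, b^L)`; the new elementary lemma `min_le_of_commute_near_axes` gives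
`min(sin θ, sin Lτ) ≤ 2Δ`, i.e. `sin(Lτ) = sin(L²s/θ) ≲ C√η ≍ C s`: `L²/θ ≲ C` — impossible as `θ → 0`.  Quantitatively the distance from the
witness to the constants/flats mod gauge is `≍ L²s/θ ≍ √η / max(δ, η^{1/4})` (up to `L`-dependent factors): on the valley set the honest modulus is
`√η/δ` (near the toron corner) — not `√η`.

## Message to lane A (COARSE-DESIGN §13–§15) and lane B
The C3c text of record is false as a statement about `valleySet L (β^{−p}) (β^{−q})` for every `p, q > 0` (no choice of exponents repairs it, the
lane's `(1/8, 3/10)` included); what survives is «`√η/δ`-close to the constants» (even `L`: to the constants in the gauge where the zero modes are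
spirals, cf. R9) or «`√η/δ`-close to FLAT», i.e. a modulus `β^{p − q/2}` instead of `β^{−q/2}` inside the Schur/Feshbach step C3a — or a valley
region that also excludes a `δ`-neighbourhood of the NON-central flat directions (the whole flat manifold, not only the eight torons), on which
`√η`-proximity to FLAT is plausible (linearised complex elliptic away from the reducible flat connections).
## WHAT THIS IS NOT
Not `¬TwistedTraceScaling`, not `¬stub_fixedLatticeTraceLaw`, not `¬ValleyKernelRowBoundAt`: a fixed-lattice geometric fact refuting an
AUXILIARY design text.  HONEST FRAMING: femto rung R2b1, stub support of a child of a CONDITIONAL reduction route; nothing about the continuum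
or the Clay gap.  Sorry-free, no new definition; axioms ⊆ {propext, Classical.choice, Quot.sound}.
-/

set_option autoImplicit false

noncomputable section

open Filter Topology
open scoped Matrix Quaternion BigOperators
open Literature.MathematicalPhysics.QuantumFieldTheory hiding SU2
open Literature.MathematicalPhysics.QuantumLattice
open Summit.QuantumFields.YangMills.Theorems.FemtoTransferGap
open Summit.QuantumFields.YangMills.Theorems.FemtoTransferGap.PhysL2 (twoLinkCfg plaquetteHolonomy_twoLinkCfg scalarPart_comm_eq)
open Summit.QuantumFields.YangMills.Theorems.FemtoTransferGap.TwoLattice.Chart (frobNorm_sub_sq_eq)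
open Summit.QuantumFields.YangMills.Theorems.FemtoTransferGap.TwoLattice.Cov (hol wilsonAction_eq_sum_scalarPart)
open Summit.QuantumFields.YangMills.Theorems.TwistedTraceScaling.Negative.R8
open Summit.QuantumFields.YangMills.Theorems.TwistedTraceScaling.Negative.R9

namespace Summit.QuantumFields.YangMills.Theorems.TwistedTraceScaling.Negative.R10
/-! ## §4 The witness scheme: parameters `s = √(η/(4#P+1))`, `θ = max(2Lδ, L√s)`, `α = θ/L`, `τ = Ls/θ`, and the endgame -/

section Scheme

set_option maxHeartbeats 400000 in
/-- **The common analytic core.**  For scale functions `δ, η → 0` (`η > 0` eventually) and any `A > 0`, `C`, `β₀`: if for all large `β` every pair of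
rotations `a_α`, `b_τ` (orthogonal axes) with `0 < α`, `Lα ≤ π/2`, `0 < τ`, `Lτ ≤ Lα`, `δ β < α` and action budget `4·#P·sin²α·sin²τ < 2η β` satisfied
the obstruction `min(sin Lα, sin Lτ) ≤ 2·L·A·C·√(η β)`, we reach a contradiction by choosing `s = √(η β/(4#P+1))`, `θ = max(2Lδ β, L√s)`,
`α = θ/L`, `τ = Ls/θ` at a `β` with `θ·(πA|C|√(4#P+1) + 1) ≤ L/2` (Jordan: `sin(Lτ) ≥ (2/π)L²s/θ`). [folklore] -/
theorem witness_scheme (L : ℕ) [NeZero L] {δ η : ℝ → ℝ} (hδ : Tendsto δ atTop (𝓝 0)) (hη : Tendsto η atTop (𝓝 0))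
    (hη0 : ∀ᶠ β in atTop, 0 < η β) {A : ℝ} (hA : 0 < A) (C β₀ : ℝ)
    (H : ∀ β : ℝ, β₀ ≤ β → 0 < η β → (L : ℝ) * (|C| * Real.sqrt (η β)) ≤ 1 / 2 →
      ∀ (a b : SU2) (α τ : ℝ), su2Quat a = ⟨Real.cos α, Real.sin α, 0, 0⟩ → su2Quat b = ⟨Real.cos τ, 0, Real.sin τ, 0⟩ →
        0 < α → (L : ℝ) * α ≤ Real.pi / 2 → 0 < τ → (L : ℝ) * τ ≤ L * α → δ β < α →
        4 * (Fintype.card (Plaquette 3 L) : ℝ) * (Real.sin α ^ 2 * Real.sin τ ^ 2) < 2 * η β →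
        min (Real.sin (L * α)) (Real.sin (L * τ)) ≤ 2 * (L * (A * (C * Real.sqrt (η β))))) : False := by
  have hLnat : 0 < L := Nat.pos_of_ne_zero (NeZero.ne L)
  have hLpos : (0 : ℝ) < L := Nat.cast_pos.2 hLnat
  have hLne : (L : ℝ) ≠ 0 := hLpos.ne'
  have hL1 : (1 : ℝ) ≤ L := by exact_mod_cast hLnat
  have hπ := Real.pi_pos
  set K : ℝ := 4 * (Fintype.card (Plaquette 3 L) : ℝ) with hK
  have hK0 : 0 ≤ K := by positivity
  have hK1 : 0 < K + 1 := by positivity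
  set M : ℝ := Real.pi * A * |C| * Real.sqrt (K + 1) + 1 with hM
  have hM0 : 0 < M := by positivity
  -- the two auxiliary scale functions tend to zero
  have hs_t : Tendsto (fun β => Real.sqrt (η β / (K + 1))) atTop (𝓝 0) := by
    have h := (hη.div_const (K + 1)).sqrt
    rwa [zero_div, Real.sqrt_zero] at h
  have hθ_t : Tendsto (fun β => max (2 * L * δ β) (L * Real.sqrt (Real.sqrt (η β / (K + 1))))) atTop (𝓝 0) := by
    have h := (hδ.const_mul (2 * (L : ℝ))).max (hs_t.sqrt.const_mul (L : ℝ))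
    rwa [Real.sqrt_zero, mul_zero, mul_zero, max_self] at h
  have hε_t : ∀ᶠ β in atTop, η β < 1 / (4 * L ^ 2 * C ^ 2 + 1) := hη.eventually_lt_const (by positivity)
  have hθ_e : ∀ᶠ β in atTop, max (2 * L * δ β) (L * Real.sqrt (Real.sqrt (η β / (K + 1)))) < min 1 (L / (2 * M)) :=
    hθ_t.eventually_lt_const (by positivity)
  obtain ⟨β, hβ₀, hηβ, hηC, hθβ⟩ := ((eventually_ge_atTop β₀).and (hη0.and (hε_t.and hθ_e))).exists
  -- the parameters at this `β`
  set s : ℝ := Real.sqrt (η β / (K + 1)) with hs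
  set θ : ℝ := max (2 * L * δ β) (L * Real.sqrt s) with hθ
  have hs0 : 0 < s := Real.sqrt_pos.2 (div_pos hηβ hK1)
  have hss : s ^ 2 = η β / (K + 1) := Real.sq_sqrt (div_pos hηβ hK1).le
  have hsη : Real.sqrt (η β) = Real.sqrt (K + 1) * s := by
    rw [hs, ← Real.sqrt_mul hK1.le, mul_div_assoc', mul_div_cancel_left₀ _ hK1.ne']
  have hθ0 : 0 < θ := lt_max_of_lt_right (by positivity)
  have hθ1 : θ ≤ 1 := hθβ.le.trans (min_le_left _ _)
  have hθM : θ * M ≤ L / 2 := by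
    have h : θ ≤ L / (2 * M) := hθβ.le.trans (min_le_right _ _)
    rw [le_div_iff₀ (by positivity)] at h; linarith
  have hθδ : 2 * L * δ β ≤ θ := le_max_left _ _
  have hθs : L * Real.sqrt s ≤ θ := le_max_right _ _
  have hθs2 : (L : ℝ) ^ 2 * s ≤ θ ^ 2 := by
    have h := pow_le_pow_left₀ (by positivity : (0 : ℝ) ≤ L * Real.sqrt s) hθs 2
    rwa [mul_pow, Real.sq_sqrt hs0.le] at h
  have hθπ : θ ≤ Real.pi / 2 := by linarith [Real.pi_gt_three]
  -- the angles
  set α : ℝ := θ / L with hα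
  set τ : ℝ := L * s / θ with hτ
  have hα0 : 0 < α := by positivity
  have hLα : (L : ℝ) * α = θ := by rw [hα, mul_div_assoc', mul_div_cancel_left₀ θ hLne]
  have hτ0 : 0 < τ := by positivity
  have hθne : θ ≠ 0 := hθ0.ne'
  have hLτθ : (L : ℝ) * τ * θ = L ^ 2 * s := by rw [hτ, mul_div_assoc', div_mul_cancel₀ _ hθne]; ring
  have hLτ : (L : ℝ) * τ ≤ θ := by
    have h : (L : ℝ) * τ * θ ≤ θ * θ := by rw [hLτθ]; linarith [hθs2]
    exact le_of_mul_le_mul_right h hθ0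
  have hατ : α * τ = s := by
    rw [hα, hτ, div_mul_div_comm, show θ * (L * s) = s * (L * θ) by ring, mul_div_assoc, div_self (mul_pos hLpos hθ0).ne', mul_one]
  have hδα : δ β < α := by
    rcases le_or_gt (δ β) 0 with h | h
    · exact h.trans_lt hα0
    · have h2 : 2 * δ β ≤ α := by rw [hα, le_div_iff₀ hLpos]; linarith
      linarith
  -- the action budget
  have hSlt : 4 * (Fintype.card (Plaquette 3 L) : ℝ) * (Real.sin α ^ 2 * Real.sin τ ^ 2) < 2 * η β := by
    have hαπ : α ≤ Real.pi := by
      have : α ≤ L * α := le_mul_of_one_le_left hα0.le hL1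
      linarith
    have hτπ : τ ≤ Real.pi := by
      have : τ ≤ L * τ := le_mul_of_one_le_left hτ0.le hL1
      linarith
    have h1 : Real.sin α ^ 2 ≤ α ^ 2 := pow_le_pow_left₀ (Real.sin_nonneg_of_nonneg_of_le_pi hα0.le hαπ) (Real.sin_le hα0.le) 2
    have h2 : Real.sin τ ^ 2 ≤ τ ^ 2 := pow_le_pow_left₀ (Real.sin_nonneg_of_nonneg_of_le_pi hτ0.le hτπ) (Real.sin_le hτ0.le) 2
    have h3 : Real.sin α ^ 2 * Real.sin τ ^ 2 ≤ s ^ 2 := by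
      rw [← hατ, mul_pow]; exact mul_le_mul h1 h2 (sq_nonneg _) (sq_nonneg _)
    have h4 : K * s ^ 2 ≤ η β := by
      rw [hss, mul_div_assoc', div_le_iff₀ hK1]; linarith [hηβ]
    calc 4 * (Fintype.card (Plaquette 3 L) : ℝ) * (Real.sin α ^ 2 * Real.sin τ ^ 2) ≤ K * s ^ 2 := mul_le_mul_of_nonneg_left h3 hK0
      _ ≤ η β := h4
      _ < 2 * η β := by linarith
  -- the closeness modulus is small
  have hε : (L : ℝ) * (|C| * Real.sqrt (η β)) ≤ 1 / 2 := by
    have hsq : Real.sqrt (η β) ^ 2 = η β := Real.sq_sqrt hηβ.le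
    have hη1 : η β * (4 * L ^ 2 * C ^ 2 + 1) < 1 := by rwa [lt_div_iff₀ (by positivity)] at hηC
    have h1 : ((L : ℝ) * (|C| * Real.sqrt (η β))) ^ 2 ≤ (1 / 2) ^ 2 := by
      have h' : ((L : ℝ) * (|C| * Real.sqrt (η β))) ^ 2 = L ^ 2 * C ^ 2 * η β := by
        rw [show ((L : ℝ) * (|C| * Real.sqrt (η β))) ^ 2 = L ^ 2 * |C| ^ 2 * Real.sqrt (η β) ^ 2 by ring, hsq, sq_abs]
      rw [h']; linarith [hηβ]
    exact (pow_le_pow_iff_left₀ (by positivity) (by norm_num) two_ne_zero).1 h1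
  -- the two rotations and the obstruction supplied by `H`
  obtain ⟨a, ha⟩ := exists_su2Quat_eq _ (normSq_axisI α)
  obtain ⟨b, hb⟩ := exists_su2Quat_eq _ (normSq_axisJ τ)
  have hkey := H β hβ₀ hηβ hε a b α τ ha hb hα0 (by rw [hLα]; exact hθπ) hτ0 (by rw [hLα]; exact hLτ) hδα hSlt
  have hLτ0 : 0 < (L : ℝ) * τ := by positivity
  have hle : Real.sin (L * τ) ≤ Real.sin (L * α) := by
    rw [hLα]; exact Real.sin_le_sin_of_le_of_le_pi_div_two (by linarith) hθπ hLτ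
  rw [min_eq_right hle] at hkey
  have hjordan : 2 / Real.pi * (L * τ) ≤ Real.sin (L * τ) := Real.mul_le_sin hLτ0.le (hLτ.trans hθπ)
  -- endgame
  have h1 : (L : ℝ) * τ ≤ Real.pi * (L * (A * (C * Real.sqrt (η β)))) := by
    have h := hjordan.trans hkey
    rw [div_mul_eq_mul_div, div_le_iff₀ hπ] at h; linarith
  have h2 : (L : ℝ) ^ 2 * s ≤ Real.pi * (L * (A * (C * Real.sqrt (η β)))) * θ := by
    rw [← hLτθ]; exact mul_le_mul_of_nonneg_right h1 hθ0.le
  have hC : C ≤ |C| := le_abs_self C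
  have h3 : Real.pi * (L * (A * (C * Real.sqrt (η β)))) * θ ≤ Real.pi * (L * (A * (|C| * Real.sqrt (η β)))) * θ := by gcongr
  have h4 : Real.pi * (L * (A * (|C| * Real.sqrt (η β)))) * θ = L * s * (θ * M) - L * s * θ := by rw [hsη, hM]; ring
  have h5 : (L : ℝ) * s * (θ * M) ≤ L * s * (L / 2) := mul_le_mul_of_nonneg_left hθM (by positivity)
  linarith [mul_pos (mul_pos hLpos hs0) hθ0, mul_pos (mul_pos hLpos hLpos) hs0]

end Scheme

/-! ## §5 ★ The refutations on the valley set -/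

section Main

set_option maxHeartbeats 400000 in
/-- ★ **R10-A. No uniform `√η`-proximity to the CONSTANTS on the valley set, at any scales `δ, η → 0` (even `L`).**  For `L` even and scale functions
`δ β → 0`, `η β → 0` (`η β > 0` eventually) there are no `C`, `β₀` such that for all `β ≥ β₀` every `U ∈ valleySet L (δ β) (η β)` — action
`< 2η β`, all eight centre-twisted copies at orbit distance `> δ β/2` from the pure gauges — is gauge equivalent to a configuration whose links are
all within Frobenius distance `C√(η β)` of a constant configuration.  Witness `twist 2 (−1) (twoLinkCfg a_{θ/L} b_{Ls/θ})`; obstruction R9's.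
[cite: Luscher1983, §2] [cite: tHooft1979] -/
theorem valleyConstProximity_sqrt_false (L : ℕ) [NeZero L] (hLe : Even L) {δ η : ℝ → ℝ}
    (hδ : Tendsto δ atTop (𝓝 0)) (hη : Tendsto η atTop (𝓝 0)) (hη0 : ∀ᶠ β in atTop, 0 < η β) :
    ¬ ∃ C β₀ : ℝ, ∀ β : ℝ, β₀ ≤ β → ∀ U ∈ valleySet L (δ β) (η β),
        ∃ (g : Site 3 L → SU2) (c : Fin 3 → SU2),
          ∀ e, frobNorm (((gaugeTransform g U e : SU2) : Matrix (Fin 2) (Fin 2) ℂ) - ((c e.2 : SU2) : Matrix (Fin 2) (Fin 2) ℂ)) ≤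
            C * Real.sqrt (η β) := by
  rintro ⟨C, β₀, H⟩
  obtain ⟨m, hm⟩ := hLe
  have hLnat : 0 < L := Nat.pos_of_ne_zero (NeZero.ne L)
  refine witness_scheme L hδ hη hη0 (A := 1 + 2 * L) (by positivity) C β₀
    fun β hβ _hηβ hε a b α τ ha hb hα0 hαL _hτ0 _hτα hδα hS => ?_
  have hmem : twist 2 negOne (twoLinkCfg (L := L) a b) ∈ valleySet L (δ β) (η β) := twist_twoLinkCfg_mem_valleySet ha hb hα0 hαL hδα hS
  obtain ⟨g, c, hclose⟩ := H β hβ _ hmem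
  set d := C * Real.sqrt (η β) with hd
  have hLd : (L : ℝ) * d ≤ 1 / 2 :=
    (mul_le_mul_of_nonneg_left (mul_le_mul_of_nonneg_right (le_abs_self C) (Real.sqrt_nonneg _)) (Nat.cast_nonneg L)).trans hε
  -- closeness to the constant configuration, and the five loop facts at the origin (as in R9)
  have hclose' : ∀ e, frobNorm (((gaugeTransform g (twist 2 negOne (twoLinkCfg (L := L) a b)) e : SU2) : Matrix (Fin 2) (Fin 2) ℂ) -
      (((fun e' : Edge 3 L => c e'.2) e : SU2) : Matrix (Fin 2) (Fin 2) ℂ)) ≤ d :=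
    fun e => hclose e
  have hd0 := frobNorm_lineHolonomy_sub_le hclose' 0 L 0
  have hd1 := frobNorm_lineHolonomy_sub_le hclose' 1 L 0
  have hd2 := frobNorm_lineHolonomy_sub_le hclose' 2 L 0
  rw [lineHolonomy_gaugeTransform_period, lineHolonomy_twist_twoLinkCfg_zero, lineHolonomy_const] at hd0
  rw [lineHolonomy_gaugeTransform_period, lineHolonomy_twist_twoLinkCfg_one, lineHolonomy_const] at hd1
  rw [lineHolonomy_gaugeTransform_period, lineHolonomy_twist_twoLinkCfg_two, lineHolonomy_const, conj_negOne] at hd2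
  have hp0 := frobNorm_plaquetteHolonomy_sub_le_of_forall hclose' 0 0 2
  have hp1 := frobNorm_plaquetteHolonomy_sub_le_of_forall hclose' 0 1 2
  rw [plaquetteHolonomy_gaugeTransform, plaquetteHolonomy_twist_twoLinkCfg_two negOne_mem_center a b 0 (by decide), mul_one, mul_inv_cancel,
    plaquetteHolonomy_const, OneMemClass.coe_one] at hp0 hp1
  exact min_sin_le_of_near_const hm hLnat ha hb hLd hd0 hd1 hd2 hp0 hp1

set_option maxHeartbeats 400000 in
/-- ★ **R10-B. No uniform `√η`-proximity to the FLAT configurations on the valley set, at any scales `δ, η → 0` (every `L ≥ 1`).**  Witness the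
untwisted `twoLinkCfg a_{θ/L} b_{Ls/θ}` (in the valley set: its Polyakov loop `a^L` keeps all eight twisted copies `≥ θ/(2L) ≥ δ` away from the
pure gauges); obstruction R8's (commuting line holonomies of a flat field). [cite: Luscher1983, §2] -/
theorem valleyFlatProximity_sqrt_false (L : ℕ) [NeZero L] {δ η : ℝ → ℝ}
    (hδ : Tendsto δ atTop (𝓝 0)) (hη : Tendsto η atTop (𝓝 0)) (hη0 : ∀ᶠ β in atTop, 0 < η β) :
    ¬ ∃ C β₀ : ℝ, ∀ β : ℝ, β₀ ≤ β → ∀ U ∈ valleySet L (δ β) (η β),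
        ∃ (g : Site 3 L → SU2) (V : GaugeConfig 3 L SU2), (∀ x i j, plaquetteHolonomy V x i j = 1) ∧
          ∀ e, frobNorm (((gaugeTransform g U e : SU2) : Matrix (Fin 2) (Fin 2) ℂ) - ((V e : SU2) : Matrix (Fin 2) (Fin 2) ℂ)) ≤
            C * Real.sqrt (η β) := by
  rintro ⟨C, β₀, H⟩
  refine witness_scheme L hδ hη hη0 (A := 1) one_pos C β₀ fun β hβ _hηβ _hε a b α τ ha hb hα0 hαL _hτ0 _hτα hδα hS => ?_
  have hmem : twoLinkCfg (L := L) a b ∈ valleySet L (δ β) (η β) := twoLinkCfg_mem_valleySet ha hb hα0 hαL hδα hS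
  obtain ⟨g, V, hV, hclose⟩ := H β hβ _ hmem
  -- move the gauge transformation onto the flat side
  have hV' : ∀ x i j, plaquetteHolonomy (gaugeTransform (fun x => (g x)⁻¹) V) x i j = 1 :=
    plaquetteHolonomy_gaugeTransform_eq_one hV _
  have hclose' : ∀ e, frobNorm (((twoLinkCfg (L := L) a b e : SU2) : Matrix (Fin 2) (Fin 2) ℂ) -
      ((gaugeTransform (fun x => (g x)⁻¹) V e : SU2) : Matrix (Fin 2) (Fin 2) ℂ)) ≤ C * Real.sqrt (η β) := fun e => by
    rw [← frobNorm_gaugeTransform_sub_swap]; exact hclose e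
  rw [one_mul]
  exact min_sin_le_of_near_flat ha hb hV' hclose'

/-! ### The polynomial scales of lane A (`powScale p β = (max β 1)^{−p}`) -/

/-- `powScale p → 0` (`p > 0`). [folklore] -/
theorem tendsto_powScale {p : ℝ} (hp : 0 < p) : Tendsto (powScale p) atTop (𝓝 0) := by
  rw [Metric.tendsto_atTop]
  intro ε hε
  obtain ⟨β0, h⟩ := powScale_eventually_le hp (half_pos hε)
  exact ⟨β0, fun β hβ => by rw [Real.dist_eq, sub_zero, abs_of_pos (powScale_pos p β)]; linarith [h β hβ]⟩

/-- ★ **R10-A at lane A's scales** `(δ, η) = (β^{−p}, β^{−q})`, ANY `p, q > 0` (the proposed `(1/8, 3/10)` included), even `L`: the C3c text of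
record «`U ∈ valleySet ⇒` mod gauge `√η`-close to a constant» is false. [cite: Luscher1983, §2] [cite: tHooft1979] -/
theorem valleyConstProximity_pow_false (L : ℕ) [NeZero L] (hLe : Even L) {p q : ℝ} (hp : 0 < p) (hq : 0 < q) :
    ¬ ∃ C β₀ : ℝ, ∀ β : ℝ, β₀ ≤ β → ∀ U ∈ valleySet L (powScale p β) (powScale q β),
        ∃ (g : Site 3 L → SU2) (c : Fin 3 → SU2),
          ∀ e, frobNorm (((gaugeTransform g U e : SU2) : Matrix (Fin 2) (Fin 2) ℂ) - ((c e.2 : SU2) : Matrix (Fin 2) (Fin 2) ℂ)) ≤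
            C * Real.sqrt (powScale q β) :=
  valleyConstProximity_sqrt_false L hLe (tendsto_powScale hp) (tendsto_powScale hq) (Eventually.of_forall fun β => powScale_pos q β)

/-- ★ **R10-B at lane A's scales**, every `L ≥ 1`: «`U ∈ valleySet L (β^{−p}) (β^{−q}) ⇒` mod gauge `√η`-close to FLAT» is false for all
`p, q > 0`. [cite: Luscher1983, §2] -/
theorem valleyFlatProximity_pow_false (L : ℕ) [NeZero L] {p q : ℝ} (hp : 0 < p) (hq : 0 < q) :
    ¬ ∃ C β₀ : ℝ, ∀ β : ℝ, β₀ ≤ β → ∀ U ∈ valleySet L (powScale p β) (powScale q β),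
        ∃ (g : Site 3 L → SU2) (V : GaugeConfig 3 L SU2), (∀ x i j, plaquetteHolonomy V x i j = 1) ∧
          ∀ e, frobNorm (((gaugeTransform g U e : SU2) : Matrix (Fin 2) (Fin 2) ℂ) - ((V e : SU2) : Matrix (Fin 2) (Fin 2) ℂ)) ≤
            C * Real.sqrt (powScale q β) :=
  valleyFlatProximity_sqrt_false L (tendsto_powScale hp) (tendsto_powScale hq) (Eventually.of_forall fun β => powScale_pos q β)

end Main

end Summit.QuantumFields.YangMills.Theorems.TwistedTraceScaling.Negative.R10

end
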